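import Mathlib
import Summits.PneNP.PneNP.Theses.ConvexRankGates
import Literature.Computability.Complexity.ExtMonotoneCliqueGate

/-!
# PneNP / ConvexRankGates — `ConvexGateBlind`, line `xor-door-perfect-completeness`: shared definitions

Route-posited objects of the crux line `xor-door-perfect-completeness` for crux `ConvexGateBlind`
(item stmt-PneNP-10680; skeleton `Cruxes/ConvexGateBlind/Lines/xor_door_perfect_completeness.lean`,
namespace `Summit.PneNP.PneNP.Cruxes.ConvexGateBlind.XorDoorPerfectCompleteness`). This file is the
single home of the line's vocabulary so that the stub files (`--supports stmt-PneNP-10680`) and the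
closing composition share ONE copy of every definition (bodies verbatim from the registered skeleton):

* §0 the target function `3XOR-UNSAT` on the 3-sparse pool (`Pool`, `Sat`, `xor3Unsat`, `viol`), the
  crux's basis `{∧₂, ∨₂} ∪ CONV_s` (`basis`, over the Literature class `IsConvGate`, which is verbatim the
  crux's inline gate class) and CONV-blindness of a family (`ConvBlind`, `Xor3UnsatConvBlind` = the
  line's transfer target `C⁺`);
* §1 monotone AND-projections of `CLIQUE` (`Lit`, `Lit.eval`, `ProjectsOnto`) and the two transport
  statements `XorIsCliqueProjection`, `Transport`;
* §2 cone factorisations through `PSD_q ⊕ ℝ^r_{≥0}` (`HasConeFact`) and the canonical cone-rank form of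
  `C⁺` (`XorConeRankHard`, `XorConeRankHardEv`);
* §3 juntas, perfect-completeness SA+SOS pseudo-expectations (`IsJunta`, `HasPerfectPseudoExp`),
  `PerfectCompleteness` (one fooled unsatisfiable instance per degree) and the ε-exact lifting statement
  `ExactLifting` (asymptotic in the gadget size for a fixed inner function).

§4 adds four elementary sanity facts from the skeleton (`xor3Unsat_monotone` — registered sub-goal —, `xor3Unsat_top`, `xor3Unsat_bot`, `HasConeFact.nonneg`). Sources for the notions: Goos–Kamath–Robere–Sokolov 2019 (the monotone
function XOR-SAT/UNSAT), Grigoriev 2001 / Schoenebeck 2008 (perfect-completeness pseudo-expectations),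
Yannakakis 1991 / Gouveia–Parrilo–Thomas 2013 (cone factorisations), Hrubeš 2020 (ε-sensitive
monotone rank). Everything here is vocabulary (no provenance tags: these are route-posited objects, not cited facts); the statements `XorIsCliqueProjection`,
`Transport`, `PerfectCompleteness`, `ExactLifting` are the line's STUBS (obligations of this route, not
cited facts) and are proved — or not — in the sibling stub files.
-/

set_option linter.dupNamespace false -- `Summit.PneNP.PneNP.…`: summit = sub-problem (D-0017)

namespace Summit.PneNP.PneNP.Theorems.XorDoor

open scoped BigOperators Classical
open Filter Finset Matrix Literature.Computability.Complexity
open Summit.PneNP.PneNP.Theses.ConvexRankGates (ConvexGateBlind)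

noncomputable section

/-! ## §0 The target function: 3XOR-UNSAT on the 3-sparse pool -/

/-- The pool of 3-sparse affine equations `y i + y j + y l = b` over `𝔽₂` on `n` variables
(`2n³` inputs; repeated indices give unit equations, never `0 = b`). (line vocabulary; verbatim from the registered skeleton) -/
abbrev Pool (n : ℕ) : Type := Fin n × Fin n × Fin n × ZMod 2

/-- `y` satisfies the pool equation `e`. (line vocabulary; verbatim from the registered skeleton) -/
def Sat {n : ℕ} (y : Fin n → ZMod 2) (e : Pool n) : Prop :=
  y e.1 + y e.2.1 + y e.2.2.1 = e.2.2.2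

/-- `3XOR-UNSAT_n`: the selected system is unsatisfiable (monotone; the GKRS function,
Göös–Kamath–Robere–Sokolov 2019). (line vocabulary; verbatim from the registered skeleton) -/
def xor3Unsat (n : ℕ) (v : Pool n → Bool) : Bool :=
  decide (¬ ∃ y : Fin n → ZMod 2, ∀ e : Pool n, v e = true → Sat y e)

/-- The number of equations of the system `F` violated by `y`. (line vocabulary; verbatim from the registered skeleton) -/
def viol {m : ℕ} (F : Finset (Pool m)) (y : Fin m → ZMod 2) : ℕ :=
  (F.filter fun e => ¬ Sat y e).card

/-- The crux's basis with parameter `s`: `{∧₂, ∨₂} ∪ CONV_s` (`IsConvGate` is, verbatim, the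
crux's inline gate class). (line vocabulary; verbatim from the registered skeleton) -/
def basis (s : ℕ) : Set GateFn := {GateFn.and 2, GateFn.or 2} ∪ {g | IsConvGate s g}

/-- CONV-blindness of a family of Boolean functions `f n` on input types `P n`: for every `c`,
eventually in `n`, no circuit over `{∧₂, ∨₂} ∪ CONV_{n^c}` with `≤ n^c` gates computes `f n`. (line vocabulary; verbatim from the registered skeleton) -/
def ConvBlind (P : ℕ → Type) (f : ∀ n, (P n → Bool) → Bool) : Prop :=
  ∀ c : ℕ, ∀ᶠ n : ℕ in atTop, ∀ C : Circuit (P n),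
    C.IsOver (basis (n ^ c)) → C.size ≤ n ^ c → ¬ C.Computes (f n)

/-- **`C⁺` (the transfer target of the line).** No polynomial `{∧₂, ∨₂} ∪ CONV` circuit computes
`3XOR-UNSAT` on the 3-sparse pool. (line vocabulary; verbatim from the registered skeleton) -/
def Xor3UnsatConvBlind : Prop := ConvBlind Pool xor3Unsat

/-! ## §1 Universality of CLIQUE under monotone AND-projections -/

/-- A monotone literal over input variables `ι`: a constant, a variable, or the AND of two
variables (the three things an edge of the CLIQUE board can be under a monotone AND-projection). (line vocabulary; verbatim from the registered skeleton) -/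
inductive Lit (ι : Type) : Type
  /-- a Boolean constant -/
  | const (b : Bool) : Lit ι
  /-- an input variable -/
  | var (a : ι) : Lit ι
  /-- the conjunction of two input variables -/
  | and (a b : ι) : Lit ι

/-- Evaluation of a literal at an input. (line vocabulary; verbatim from the registered skeleton) -/
def Lit.eval {ι : Type} (v : ι → Bool) : Lit ι → Bool
  | Lit.const b => b
  | Lit.var a => v a
  | Lit.and a b => v a && v b

/-- `f` is a monotone AND-projection of `CLIQUE(M, k)`: substituting a literal for every edge of
`K_M` turns the clique function into `f`. (line vocabulary; verbatim from the registered skeleton) -/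
def ProjectsOnto (M k : ℕ) {ι : Type} (f : (ι → Bool) → Bool) : Prop :=
  ∃ ρ : (⊤ : SimpleGraph (Fin M)).edgeSet → Lit ι,
    ∀ v : ι → Bool, cliqueFn M k (fun e => (ρ e).eval v) = f v

/-- **Stub statement (T1) of the line.** `3XOR-UNSAT_n` is a monotone AND-projection of `CLIQUE(M, k)`
with `M, k ≤ (n+2)^a` (derivation gadget: positions (step `j ≤ 2n³`, coordinate `i ≤ n` or RHS) carrying
(state before, state after, chosen equation), pairwise consistency edges, vertices of equation `C`
AND-masked by `v_C`; a `k`-clique = a derivation of `0 = 1` from selected equations). (line vocabulary; verbatim from the registered skeleton) -/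
def XorIsCliqueProjection : Prop :=
  ∃ a : ℕ, ∀ n : ℕ, ∃ M k : ℕ, M ≤ (n + 2) ^ a ∧ k ≤ (n + 2) ^ a ∧ ProjectsOnto M k (xor3Unsat n)

/-- **Stub statement (T2) of the line, generic transport.** CONV-circuit hardness moves DOWN along
polynomial monotone AND-projections of `CLIQUE`: if every `f n` is an AND-projection of some
`CLIQUE(M, k)` with `M, k ≤ (n+2)^a`, then CONV-blindness of `f` implies the crux `ConvexGateBlind`
(embed `K_M` into `K_m` with `⌈m^δ⌉ - k` apex vertices and the rest isolated, substitute literals by `∧₂`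
gates and constant gates; infinitely many easy `m` give infinitely many easy `n(m) → ∞`). (line vocabulary; verbatim from the registered skeleton) -/
def Transport : Prop :=
  ∀ (P : ℕ → Type) (f : ∀ n, (P n → Bool) → Bool),
    (∃ a : ℕ, ∀ n : ℕ, ∃ M k : ℕ, M ≤ (n + 2) ^ a ∧ k ≤ (n + 2) ^ a ∧ ProjectsOnto M k (f n)) →
    ConvBlind P f → ConvexGateBlind

/-! ## §2 The canonical (cone-rank) form of `C⁺` -/

/-- A `(PSD_q ⊕ ℝ^r_{≥0})`-factorisation of the real matrix `M`:
`M a b = tr(H_a Y_b) + ∑_{l<r} U_{a,l} V_{l,b}` with `H_a, Y_b ⪰ 0` (`q × q`) and `U, V ≥ 0`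
(Yannakakis 1991; Gouveia–Parrilo–Thomas 2013). (line vocabulary; verbatim from the registered skeleton) -/
def HasConeFact {α β : Type} (M : α → β → ℝ) (q r : ℕ) : Prop :=
  ∃ (H : α → Matrix (Fin q) (Fin q) ℝ) (Y : β → Matrix (Fin q) (Fin q) ℝ)
    (U : α → Fin r → ℝ) (V : Fin r → β → ℝ),
    (∀ a, (H a).PosSemidef) ∧ (∀ b, (Y b).PosSemidef) ∧ (∀ a l, 0 ≤ U a l) ∧ (∀ l b, 0 ≤ V l b) ∧
    ∀ a b, M a b = (H a * Y b).trace + ∑ l, U a l * V l b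

/-- `XorConeRankHard n c`: for every `ε > 0`, the shifted one-sided distance matrix
`#(v ∖ u) - ε` (rows: satisfiable systems `u` = rejected inputs; columns: unsatisfiable systems `v`
= accepted inputs) has no `(PSD_q ⊕ ℝ^r_{≥0})`-factorisation with `q + r ≤ n^c` (the XOR analogue of
`convexGateBlind_iff_cliqueDistConeRankHard`; LP slice = Hrubeš's `min_ε rk_+(M_+(f) - εJ)` for
`f = 3XOR-UNSAT_n`). (line vocabulary; verbatim from the registered skeleton) -/
def XorConeRankHard (n c : ℕ) : Prop :=
  ∀ ε : ℝ, 0 < ε → ∀ q r : ℕ, q + r ≤ n ^ c →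
    ¬ HasConeFact
      (fun (u : {u : Pool n → Bool // xor3Unsat n u = false})
           (v : {v : Pool n → Bool // xor3Unsat n v = true}) =>
        (∑ e : Pool n, if v.1 e = true ∧ u.1 e = false then (1 : ℝ) else 0) - ε) q r

/-- Eventual form: for every `c`, eventually in `n`, `XorConeRankHard n c`. (line vocabulary; verbatim from the registered skeleton) -/
def XorConeRankHardEv : Prop := ∀ c : ℕ, ∀ᶠ n : ℕ in atTop, XorConeRankHard n c

/-! ## §3 Perfect-completeness pseudo-expectations and ε-exact lifting -/

/-- `h` depends on at most `d` coordinates. (line vocabulary; verbatim from the registered skeleton) -/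
def IsJunta {m : ℕ} (d : ℕ) (h : (Fin m → ZMod 2) → ℝ) : Prop :=
  ∃ S : Finset (Fin m), S.card ≤ d ∧ ∀ x y : Fin m → ZMod 2, (∀ i ∈ S, x i = y i) → h x = h y

/-- A degree-`d` PERFECT-COMPLETENESS (Sherali–Adams + SOS) pseudo-expectation for the 3-sparse system
`F` on `m` variables: a linear functional on real functions of `𝔽₂^m`, non-negative on non-negative
`d`-juntas and on squares of functions of degree `≤ d/2` (degree `e` = the linear span of `e`-juntas),
normalised (`Ẽ[1] = 1`) and satisfying every equation of `F` exactly (`Ẽ[viol_F] = 0`)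
(Grigoriev 2001; Schoenebeck 2008). (line vocabulary; verbatim from the registered skeleton) -/
def HasPerfectPseudoExp {m : ℕ} (d : ℕ) (F : Finset (Pool m)) : Prop :=
  ∃ E : ((Fin m → ZMod 2) → ℝ) →ₗ[ℝ] ℝ,
    (∀ h : (Fin m → ZMod 2) → ℝ, IsJunta d h → (∀ x, 0 ≤ h x) → 0 ≤ E h) ∧
    (∀ s : (Fin m → ZMod 2) → ℝ,
      s ∈ Submodule.span ℝ {f : (Fin m → ZMod 2) → ℝ | IsJunta (d / 2) f} → 0 ≤ E (s * s)) ∧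
    E (fun _ => 1) = 1 ∧ E (fun y => (viol F y : ℝ)) = 0

/-- **Stub statement of the line (perfect completeness at every degree).** For every degree `d` there
is an UNSATISFIABLE 3-sparse system `F` (on some number `m` of variables) with a degree-`d`
perfect-completeness SA+SOS pseudo-expectation (Grigoriev 2001; Schoenebeck 2008: Tseitin
contradictions on cubic graphs of Gaussian width `> 2d`). (line vocabulary; verbatim from the registered skeleton) -/
def PerfectCompleteness : Prop :=
  ∀ d : ℕ, ∃ (m : ℕ) (F : Finset (Pool m)),
    (¬ ∃ y : Fin m → ZMod 2, ∀ e ∈ F, Sat y e) ∧ HasPerfectPseudoExp d F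

/-- **Stub statement of the line (ε-EXACT LIFTING, asymptotic form; the open step).** There is an
unbounded `φ : ℕ → ℕ` such that for every unsatisfiable 3-sparse system `F` on `m` variables carrying a
degree-`d` perfect-completeness pseudo-expectation there is a gadget size `T` (depending on `m, d, F`
only, not on `ε`) beyond which, for every `ε > 0`, every `(PSD_q ⊕ ℝ^r_{≥0})`-factorisation of the
Index-lift `(x, w) ↦ viol_F(x[w]) - ε` (`x : Fin m → Fin t → 𝔽₂`, `w : Fin m → Fin t`) has
`q + r ≥ t^{φ(d)}` (size-from-degree transfer of KMR / LRS type for a fixed inner function, without the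
additive accuracy loss). (line vocabulary; verbatim from the registered skeleton) -/
def ExactLifting : Prop :=
  ∃ φ : ℕ → ℕ, (∀ K : ℕ, ∃ d : ℕ, K ≤ φ d) ∧
    ∀ (m d : ℕ) (F : Finset (Pool m)),
      (¬ ∃ y : Fin m → ZMod 2, ∀ e ∈ F, Sat y e) → HasPerfectPseudoExp d F →
      ∃ T : ℕ, ∀ (t : ℕ) (ε : ℝ), T ≤ t → 0 < ε → ∀ q r : ℕ,
        HasConeFact (fun (x : Fin m → Fin t → ZMod 2) (w : Fin m → Fin t) =>
          (viol F (fun i => x i (w i)) : ℝ) - ε) q r →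
        t ^ φ d ≤ q + r


/-! ## §4 Elementary sanity facts (sorry-free; from the skeleton's §6) -/

/-- `xor3Unsat` is monotone: adding equations preserves unsatisfiability (registered sub-goal
`xor3Unsat_monotone` of stmt-PneNP-10680; it is what makes `3XOR-UNSAT` a legitimate target of a
MONOTONE projection from CLIQUE). -/
theorem xor3Unsat_monotone : ∀ n : ℕ, Monotone (xor3Unsat n) := by
  intro n u v huv
  unfold xor3Unsat
  simp only [Bool.le_iff_imp, decide_eq_true_eq]
  rintro hu ⟨y, hy⟩
  exact hu ⟨y, fun e he => hy e (by have := huv e; rw [he] at this; exact top_le_iff.1 this)⟩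

/-- The full pool is unsatisfiable for `n ≥ 1` (it contains `y0+y0+y0 = 0` and `= 1`), so `xor3Unsat n`
is not constant. -/
theorem xor3Unsat_top {n : ℕ} (hn : 1 ≤ n) : xor3Unsat n (fun _ => true) = true := by
  unfold xor3Unsat
  rw [decide_eq_true_eq]
  rintro ⟨y, hy⟩
  have h0 := hy (⟨0, hn⟩, ⟨0, hn⟩, ⟨0, hn⟩, 0) rfl
  have h1 := hy (⟨0, hn⟩, ⟨0, hn⟩, ⟨0, hn⟩, 1) rfl
  simp only [Sat] at h0 h1
  rw [h0] at h1
  exact zero_ne_one h1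

/-- The empty system is satisfiable. -/
theorem xor3Unsat_bot (n : ℕ) : xor3Unsat n (fun _ => false) = false := by
  unfold xor3Unsat
  simp

/-- A matrix with a negative entry has no cone factorisation (so `ExactLifting` and `XorConeRankHard`
only ever speak about entrywise non-negative matrices): `tr(H Y) ≥ 0` for PSD `H, Y` by Schur's product
theorem. -/
theorem HasConeFact.nonneg {α β : Type} {M : α → β → ℝ} {q r : ℕ} (h : HasConeFact M q r)
    (a : α) (b : β) : 0 ≤ M a b := by
  obtain ⟨H, Y, U, V, hH, hY, hU, hV, hM⟩ := h
  rw [hM a b]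
  refine add_nonneg ?_ (Finset.sum_nonneg fun l _ => mul_nonneg (hU a l) (hV l b))
  have hYt : (Y b)ᵀ.PosSemidef := (hY b).transpose
  have hhad := ((hH a).hadamard hYt).dotProduct_mulVec_nonneg (fun _ => 1)
  have h : star (fun _ : Fin q => (1 : ℝ)) ⬝ᵥ ((H a ⊙ (Y b)ᵀ) *ᵥ fun _ => 1) = (H a * Y b).trace := by
    simp only [dotProduct, mulVec, Pi.star_apply, star_trivial, one_mul, mul_one,
      Matrix.hadamard_apply, Matrix.transpose_apply, Matrix.trace, Matrix.diag_apply, Matrix.mul_apply]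
  rw [h] at hhad
  exact hhad

end

end Summit.PneNP.PneNP.Theorems.XorDoor
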